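import Summits.BirchSwinnertonDyer.BirchSwinnertonDyer.Theorems.QuadraticBranchSignedControlPlusEtaNonsurjThetaFunctionalEquationExactBranch
import Literature.NumberTheory.EllipticCurves.IwasawaAlgebraGeneratorChange
import HarnessLib

/-!
# Route `QuadraticBranchSignedControl` (rung K8, cell `bsd-potss`), residual crux `PlusEtaMainConjectureNonsurj`
# (stmt-BirchSwinnertonDyer-19606): THE FUNCTIONAL EQUATION ON THE QUADRATIC BRANCH, XXIII — THE NORM COORDINATE OF THE
# IWASAWA INVOLUTION: `S = T·(1+T)^{−1/2}`, `S² = Z = T + ιT = T²/(1+T)`, **`ι S = −S`**, and THE FIXED RING **`Λ^ι = ℤ_p⟦T + ιT⟧`**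
# (seat `bsd-potss-k8eta-c2` g30; kernel, generic `Λ`-algebra, fact-free)

WHY. Parts IX–XXII put the exact functional equation `ι L = w·(1+T)^e·L` (`ι : T ↦ (1+T)⁻¹ − 1`, `w = ±1`, `e ∈ ℤ_p`) on every
`L_p^±(V, η, X)` of the crux and read consequences coefficient by coefficient (sub-leading law, parity, reciprocity of the Weierstrass
polynomial, `ι`-pairs of zeros). Behind all of them is ONE piece of commutative algebra, listed as NEXT (2) by g29 and used as an
unproved rationale by g28's census P-28E («`M = (1+T)^{−e/2}·D^r·N(T²/(1+T))`»): for odd `p` the involution `ι` of `Λ = ℤ_p⟦T⟧` is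
CONJUGATE TO THE SIGN CHANGE `T ↦ −T`. Put `S = T·(1+T)^r` with `2r = −1` (`r ∈ ℤ_p` since `p` is odd; `(1+T)^r` the binomial
series). Then `ι((1+T)^e) = (1+T)^{−e}` and `ιT = −T(1+T)^{−1}` give **`ι S = −S`**, and `S² = T²(1+T)^{−1} = T + ιT = −T·ιT =: Z`;
`T ↦ S` is a `ℤ_p`-algebra automorphism `σ` of `Λ` (`S = T·unit`; Mathlib's compositional inverse `PowerSeries.substInv`), and
`ι ∘ σ = σ ∘ ν` with `ν G(T) = G(−T)`. Consequently the `ι`-invariants are the EVEN series in `S`, i.e. **`Λ^ι = {H(Z)} = ℤ_p⟦T + ιT⟧`**,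
the anti-invariants are `S·ℤ_p⟦Z⟧`, and `H ↦ H(Z)` is injective. Part XXIV: `Λ = ℤ_p⟦Z⟧ ⊕ S·ℤ_p⟦Z⟧` and the solutions of
`ι M = w(1+T)^e M` (every `L_p^±(V, η, X)`): `M = (1+T)^{−e/2}·S^{ord M}·N(Z)`.

MATHEMATICS (Washington §7.1/§13.2 conventions; `Λ = ℤ_p⟦T⟧`, `(1+T)^e = PowerSeries.binomialSeries ℤ_[p] e`).
(§64) `2r = −1` has a solution in `ℤ_p` (`p` odd); `(1+T)·(1+T)^{−1} = 1`, `(1+T)^{−1} − 1 = ιT` (the tree's `invSubOne`);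
**`ι((1+T)^e) = (1+T)^{−e}`** (the tree's `binomialSeries_mul_eq_subst`: `(1+T)^{xy} = ((1+T)^x)^y` at `x = −1`); `ιT = −T(1+T)^{−1}`;
**`ι(T(1+T)^r) = −T(1+T)^r`**; `(T(1+T)^r)² = T²(1+T)^{−1}`; `T + ιT = T²(1+T)^{−1}`, `T·ιT = −(T + ιT)`, `(1+T)(T + ιT) = T²`,
`ι(T + ιT) = T + ιT`, `T² = (T+ιT)·T + (T+ιT)`. (§65) `σ = subst S`, `σ⁻¹ = subst S⁻¹` (`S⁻¹ = substInvOfIsUnit S`), `σ σ⁻¹ = σ⁻¹ σ = id`;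
**`ι(G(S)) = G(−S) = (νG)(S)`**; `σ(T²) = Z`, `σ(K(T²)) = K(Z)`. (§66) even / odd series: `νG = G ⟹ G = K(T²)`, `νG = −G ⟹ G = T·K(T²)`
(`2 ≠ 0` in `ℤ_p`); **`ι f = f ⟺ ∃ H, f = H(T + ιT)`**; **`ι f = −f ⟺ ∃ H, f = S·H(T + ιT)`**; `H(T+ιT) = 0 ⟹ H = 0` (orders double).

WHAT (41 theorems). §64 `exists_two_mul_eq_neg_one`, `one_add_X_mul_binomialSeries_neg_one_iwasawa`, `binomialSeries_neg_one_sub_one_eq_invSubOne`,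
**`invol_binomialSeries`**, `invol_X_eq_neg_X_mul_binomialSeries`, **`invol_sqrtZ`** (`ι S = −S`), `sqrtZ_sq`, `sqrtZ_sq_eq_X_add_invol_X`,
`X_add_invol_X_eq`, `X_mul_invol_X_eq`, `one_add_X_mul_X_add_invol_X`, `invol_X_add_invol_X`, `X_sq_eq_trace_mul_X_add_trace`,
`constantCoeff_/coeff_one_/coeff_two_X_add_invol_X`; §65 (hypotheses `hS : S = X * binomialSeries ℤ_[p] r`, `hZ : Z = X + invol p X`)
`constantCoeff_sqrtZ`, `hasSubst_sqrtZ`, `coeff_one_sqrtZ`, `isUnit_coeff_one_sqrtZ`, `sqrtZ_ne_zero`, `hasSubst_trace`, `subst_C_eq`,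
`subst_C_mul`, `constantCoeff_subst_eq`, `subst_sqrtZ_subst_substInv`, `subst_substInv_subst_sqrtZ`, `subst_sqrtZ_injective`,
**`invol_subst_sqrtZ`**, `subst_sqrtZ_X_sq`, `subst_sqrtZ_subst_X_sq`, `invol_subst_trace`, `invol_sqrtZ_mul_subst_trace`,
`constantCoeff_subst_trace`; §66 `eq_subst_X_sq_of_rescale_eq_self`, `eq_X_mul_subst_X_sq_of_rescale_eq_neg`,
**`invol_eq_self_iff_exists_subst`**, **`invol_eq_neg_iff_exists_sqrtZ_mul_subst`**, `order_trace`, `order_subst_trace`,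
**`subst_trace_injective`** (the decomposition `Λ = ℤ_p⟦Z⟧ ⊕ S·ℤ_p⟦Z⟧` and the functional equation follow in Part XXIV).

HONEST FRAMING (cell `bsd-potss`; FULL-BSD rank ≤ 1 programme, HUMAN RULING D-0036/D-0074): TOOL THEOREMS ONLY — pure commutative
algebra of `Λ = ℤ_p⟦T⟧`; no definition (the elements `S = X * binomialSeries ℤ_[p] r`, `2r = −1`, and `Z = X + invol p X` are written
out; `sqrtZ` / `trace` are only name tokens), no named fact, no `sorry`, axioms standard; nothing about (A), (C1⁺_η), C-cc-1 or
`BSD(W,p)` of any pair is claimed; no stub of 19606 is proved; crux and route OPEN; nothing booked. `--supports stmt-BirchSwinnertonDyer-19606`.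

References: [Washington1997] §7.1 (Λ, units, substitutions), §13.2 (`γ ↦ 1+T`, `ι`); [MazurTateTeitelbaum1986Invent] §I.17 (the involution
in the functional equation); [GreenbergLNM1716] §1 (pp. 67–68); [Sprung2017] Cor. 4.14 and [BianchiSprung2019] Thm. 5.1 (half-integral
exponents `(1+T)^{−e/2}` in the functional equation at supersingular primes). Tree: `IwasawaAlgebraInvolution.lean` (`invol`, `invSubOne`),
`IwasawaAlgebraGeneratorChange.lean` (`binomialSeries_mul_eq_subst`), Part X `…ExactBranch` (`eq_invSubOne_of_one_add_X_mul_eq_one`);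
Mathlib `PowerSeries.substInvOfIsUnit`, `PowerSeries.rescale`, `PowerSeries.binomialSeries_add/_nat`, `PowerSeries.coeff_subst_X_pow`.
-/

set_option autoImplicit false
set_option linter.dupNamespace false
noncomputable section

open scoped Classical Topology

open PowerSeries Literature.NumberTheory.EllipticCurves Literature.NumberTheory.EllipticCurves.IwasawaAlgebra

namespace Summit.BirchSwinnertonDyer.BirchSwinnertonDyer.Theorems.EtaThetaFunctionalEquation

variable {p : ℕ} [hp : Fact p.Prime]

/-! ## §64 The half exponent `2r = −1`, `ι((1+T)^e) = (1+T)^{−e}`, the square root `S = T(1+T)^r` of `Z = T + ιT`, `ι S = −S` -/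

/-- `2 ∈ ℤ_pˣ` for odd `p`, so `−1/2 ∈ ℤ_p`: there is `r ∈ ℤ_p` with `2r = −1`. [folklore] -/
theorem exists_two_mul_eq_neg_one (hp2 : p ≠ 2) : ∃ r : ℤ_[p], 2 * r = -1 := by
  have h : IsUnit ((2 : ℕ) : ℤ_[p]) := by
    rw [PadicInt.isUnit_iff, PadicInt.norm_natCast_eq_one_iff]
    exact (Nat.coprime_primes hp.out Nat.prime_two).mpr hp2
  obtain ⟨u, hu⟩ := h
  refine ⟨-((u⁻¹ : ℤ_[p]ˣ) : ℤ_[p]), ?_⟩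
  have h2 : (2 : ℤ_[p]) = (u : ℤ_[p]) := by rw [hu]; norm_num
  rw [mul_neg, h2, Units.mul_inv]

/-- `(1+T)·(1+T)^{−1} = 1` in `Λ = ℤ_p⟦T⟧` (`(1+T)^{1}·(1+T)^{−1} = (1+T)^0`). [cite: Washington1997, §7.1] -/
theorem one_add_X_mul_binomialSeries_neg_one_iwasawa :
    (1 + X : IwasawaAlgebra p) * binomialSeries ℤ_[p] (-1 : ℤ_[p]) = 1 := by
  have h := binomialSeries_add (A := ℤ_[p]) (1 : ℤ_[p]) (-1)
  have h1 : binomialSeries ℤ_[p] (1 : ℤ_[p]) = 1 + X := by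
    simpa using binomialSeries_nat (A := ℤ_[p]) (R := ℤ_[p]) 1
  rw [add_neg_cancel, binomialSeries_zero, h1] at h
  exact h.symm

/-- `(1+T)^{−1} − 1 = ι T` (`= invSubOne p`, the tree's `(1+T)⁻¹ − 1`): uniqueness of the inverse of `1 + T` (Part X's
`eq_invSubOne_of_one_add_X_mul_eq_one`). [cite: Washington1997, §13.2] -/
theorem binomialSeries_neg_one_sub_one_eq_invSubOne :
    binomialSeries ℤ_[p] (-1 : ℤ_[p]) - 1 = invSubOne p :=
  eq_invSubOne_of_one_add_X_mul_eq_one (by rw [sub_add_cancel]; exact one_add_X_mul_binomialSeries_neg_one_iwasawa)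

/-- **`ι((1+T)^e) = (1+T)^{−e}`** for every `p`-adic exponent `e`: `ι` substitutes `T ↦ (1+T)^{−1} − 1`, and
`((1+T)^{−1})^e = (1+T)^{−e}` (the tree's `binomialSeries_mul_eq_subst`). [cite: Washington1997, §13.2] -/
theorem invol_binomialSeries (e : ℤ_[p]) :
    invol p (binomialSeries ℤ_[p] e) = binomialSeries ℤ_[p] (-e) := by
  rw [invol_apply, ← binomialSeries_neg_one_sub_one_eq_invSubOne, ← binomialSeries_mul_eq_subst, neg_one_mul]

/-- `ι T = −T·(1+T)^{−1}`. [cite: Washington1997, §13.2] [cite: MazurTateTeitelbaum1986Invent, §I.17] -/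
theorem invol_X_eq_neg_X_mul_binomialSeries :
    invol p X = -(X * binomialSeries ℤ_[p] (-1 : ℤ_[p])) := by
  rw [invol_X, ← binomialSeries_neg_one_sub_one_eq_invSubOne]
  linear_combination one_add_X_mul_binomialSeries_neg_one_iwasawa (p := p)

/-- **`ι S = −S` for the square root `S = T·(1+T)^r`, `2r = −1`** (name token `sqrtZ`): `ι(T(1+T)^r) = −T(1+T)^{−1}(1+T)^{−r}
= −T(1+T)^{−1−r}` and `−1 − r = r`. So the Iwasawa involution acts on `S` as the sign change. [cite: Washington1997, §13.2] -/
theorem invol_sqrtZ {r : ℤ_[p]} (hr : 2 * r = -1) :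
    invol p (X * binomialSeries ℤ_[p] r) = -(X * binomialSeries ℤ_[p] r) := by
  have h : (-1 : ℤ_[p]) + -r = r := by linear_combination -hr
  rw [map_mul, invol_binomialSeries, invol_X_eq_neg_X_mul_binomialSeries, neg_mul, mul_assoc, ← binomialSeries_add, h]

/-- `S² = T²·(1+T)^{−1}` (`2r = −1`). [cite: Washington1997, §7.1] -/
theorem sqrtZ_sq {r : ℤ_[p]} (hr : 2 * r = -1) :
    (X * binomialSeries ℤ_[p] r) ^ 2 = X ^ 2 * binomialSeries ℤ_[p] (-1 : ℤ_[p]) := by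
  rw [mul_pow, sq (binomialSeries _ r), ← binomialSeries_add, ← two_mul, hr]

/-- **`T + ιT = T²·(1+T)^{−1}`** (the trace of `T` over the fixed ring; name token `trace` / `Z`). [cite: Washington1997, §13.2] -/
theorem X_add_invol_X_eq : X + invol p X = X ^ 2 * binomialSeries ℤ_[p] (-1 : ℤ_[p]) := by
  rw [invol_X_eq_neg_X_mul_binomialSeries]
  linear_combination (-(X : IwasawaAlgebra p)) * one_add_X_mul_binomialSeries_neg_one_iwasawa (p := p)

/-- `S² = T + ιT` (`2r = −1`). [cite: Washington1997, §13.2] -/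
theorem sqrtZ_sq_eq_X_add_invol_X {r : ℤ_[p]} (hr : 2 * r = -1) :
    (X * binomialSeries ℤ_[p] r) ^ 2 = X + invol p X := by
  rw [sqrtZ_sq hr, X_add_invol_X_eq]

/-- **`T·ιT = −(T + ιT)`**: the norm of `T` is minus its trace, so the fixed ring `ℤ_p⟦T+ιT, T·ιT⟧` is `ℤ_p⟦T + ιT⟧`.
[cite: Washington1997, §13.2] -/
theorem X_mul_invol_X_eq : X * invol p X = -(X + invol p X) := by
  rw [X_add_invol_X_eq, invol_X_eq_neg_X_mul_binomialSeries]
  ring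

/-- `(1+T)·(T + ιT) = T²`. [cite: Washington1997, §13.2] -/
theorem one_add_X_mul_X_add_invol_X : (1 + X) * (X + invol p X) = X ^ 2 := by
  rw [X_add_invol_X_eq, mul_left_comm, one_add_X_mul_binomialSeries_neg_one_iwasawa, mul_one]

/-- **`ι(T + ιT) = T + ιT`**. [cite: MazurTateTeitelbaum1986Invent, §I.17] -/
theorem invol_X_add_invol_X : invol p (X + invol p X) = X + invol p X := by
  rw [map_add, invol_invol, add_comm]

/-- `T² = (T+ιT)·T + (T+ιT)`: `T` (and `ιT`) is a root of `U² − Z·U − Z` over the fixed ring, `Z = T + ιT`. [cite: Washington1997, §13.2] -/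
theorem X_sq_eq_trace_mul_X_add_trace : (X : IwasawaAlgebra p) ^ 2 = (X + invol p X) * X + (X + invol p X) := by
  rw [X_add_invol_X_eq]
  linear_combination (-(X : IwasawaAlgebra p) ^ 2) * one_add_X_mul_binomialSeries_neg_one_iwasawa (p := p)

/-- `T + ιT` has zero constant term. [cite: Washington1997, §13.2] -/
theorem constantCoeff_X_add_invol_X : constantCoeff (X + invol p X) = 0 := by
  rw [map_add, constantCoeff_X, constantCoeff_invol_X, add_zero]

/-- `coeff_1 (T + ιT) = 0` (`ιT = −T + T² − ⋯`). [cite: Washington1997, §13.2] -/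
theorem coeff_one_X_add_invol_X : coeff 1 (X + invol p X) = 0 := by
  rw [map_add, coeff_one_X, invol_X, coeff_one_invSubOne, add_neg_cancel]

/-- `coeff_2 (T + ιT) = 1`: `T + ιT = T² − T³ + ⋯` has order EXACTLY `2`. [cite: Washington1997, §13.2] -/
theorem coeff_two_X_add_invol_X : coeff 2 (X + invol p X) = 1 := by
  have h := congr_arg (coeff 2) (one_add_X_mul_X_add_invol_X (p := p))
  rw [add_mul, one_mul, map_add, coeff_X_pow_self, show (2 : ℕ) = 1 + 1 from rfl, coeff_succ_X_mul,
    coeff_one_X_add_invol_X, add_zero] at h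
  exact h

/-! ## §65 The conjugation `σ : T ↦ S`: an automorphism of `Λ` with `ι ∘ σ = σ ∘ ν`, `ν : T ↦ −T`

Statements below take the defining equations `hS : S = X * binomialSeries ℤ_[p] r` (`2r = −1`) and `hZ : Z = X + invol p X` as
hypotheses on variables `S Z : Λ` (no definition is introduced). -/

section NormCoordinate

variable {r : ℤ_[p]} {S Z : IwasawaAlgebra p}

/-- `S = T(1+T)^r` has zero constant term. [cite: Washington1997, §7.1] -/
theorem constantCoeff_sqrtZ (hS : S = X * binomialSeries ℤ_[p] r) : constantCoeff S = 0 := by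
  rw [hS, map_mul, constantCoeff_X, zero_mul]

/-- `S` may be substituted. [cite: Washington1997, §7.1] -/
theorem hasSubst_sqrtZ (hS : S = X * binomialSeries ℤ_[p] r) : HasSubst S :=
  HasSubst.of_constantCoeff_zero' (constantCoeff_sqrtZ hS)

/-- `coeff_1 S = 1`: `S ≡ T (mod T²)`. [cite: Washington1997, §7.1] -/
theorem coeff_one_sqrtZ (hS : S = X * binomialSeries ℤ_[p] r) : coeff 1 S = 1 := by
  rw [hS, show (1 : ℕ) = 0 + 1 from rfl, coeff_succ_X_mul, coeff_zero_eq_constantCoeff, binomialSeries_constantCoeff]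

/-- The linear coefficient of `S` is a unit (so `T ↦ S` is invertible: Mathlib `PowerSeries.substInvOfIsUnit`). [cite: Washington1997, §7.1] -/
theorem isUnit_coeff_one_sqrtZ (hS : S = X * binomialSeries ℤ_[p] r) : IsUnit (coeff 1 S) := by
  rw [coeff_one_sqrtZ hS]; exact isUnit_one

/-- `S ≠ 0`. [cite: Washington1997, §7.1] -/
theorem sqrtZ_ne_zero (hS : S = X * binomialSeries ℤ_[p] r) : S ≠ 0 := fun h ↦ by
  simpa [coeff_one_sqrtZ hS] using congr_arg (coeff 1) h

/-- `Z = T + ιT` has zero constant term, so it may be substituted. [cite: Washington1997, §13.2] -/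
theorem hasSubst_trace (hZ : Z = X + invol p X) : HasSubst Z :=
  HasSubst.of_constantCoeff_zero' (by rw [hZ]; exact constantCoeff_X_add_invol_X)

/-- Substitution fixes constants (`PowerSeries` form of Mathlib's `subst_C`). [folklore] -/
theorem subst_C_eq (a : IwasawaAlgebra p) (c : ℤ_[p]) :
    PowerSeries.subst a (C c : IwasawaAlgebra p) = C c := by
  rw [PowerSeries.subst_C]
  rfl

/-- `(c·f)(a) = c·f(a)` for a constant `c`. [folklore] -/
theorem subst_C_mul {a : IwasawaAlgebra p} (ha : HasSubst a) (c : ℤ_[p]) (f : IwasawaAlgebra p) :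
    PowerSeries.subst a (C c * f : IwasawaAlgebra p) = C c * PowerSeries.subst a f := by
  rw [subst_mul ha, subst_C_eq]

/-- The constant term is unchanged by substituting a series without constant term: `f(a)(0) = f(0)`. [folklore] -/
theorem constantCoeff_subst_eq {a : IwasawaAlgebra p} (ha0 : constantCoeff a = 0) (f : IwasawaAlgebra p) :
    constantCoeff (PowerSeries.subst a f : IwasawaAlgebra p) = constantCoeff f := by
  have ha : HasSubst a := HasSubst.of_constantCoeff_zero' ha0
  conv_lhs => rw [eq_X_mul_shift_add_const f]
  rw [subst_add ha, subst_mul ha, subst_X ha, subst_C_eq, map_add, map_mul, ha0, zero_mul, zero_add, constantCoeff_C]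

/-- **`σ ∘ σ⁻¹ = id`**: with `S⁻¹ = substInvOfIsUnit S` (Mathlib's compositional inverse of `S = T + O(T²)`), `(f(S⁻¹))(S) = f`.
[cite: Washington1997, §7.1] -/
theorem subst_sqrtZ_subst_substInv (hS : S = X * binomialSeries ℤ_[p] r) (f : IwasawaAlgebra p) :
    PowerSeries.subst S (PowerSeries.subst (substInvOfIsUnit S (isUnit_coeff_one_sqrtZ hS)) f : IwasawaAlgebra p) = f := by
  rw [subst_comp_subst_apply (HasSubst.substInvOfIsUnit _ _) (hasSubst_sqrtZ hS),
    subst_substInvOfIsUnit_left _ (constantCoeff_sqrtZ hS), X_subst]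

/-- **`σ⁻¹ ∘ σ = id`**: `(G(S))(S⁻¹) = G`. [cite: Washington1997, §7.1] -/
theorem subst_substInv_subst_sqrtZ (hS : S = X * binomialSeries ℤ_[p] r) (G : IwasawaAlgebra p) :
    PowerSeries.subst (substInvOfIsUnit S (isUnit_coeff_one_sqrtZ hS)) (PowerSeries.subst S G : IwasawaAlgebra p) = G := by
  rw [subst_comp_subst_apply (hasSubst_sqrtZ hS) (HasSubst.substInvOfIsUnit _ _),
    subst_substInvOfIsUnit_right _ (constantCoeff_sqrtZ hS), X_subst]

/-- `σ : G ↦ G(S)` is injective. [cite: Washington1997, §7.1] -/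
theorem subst_sqrtZ_injective (hS : S = X * binomialSeries ℤ_[p] r) :
    Function.Injective (fun G : IwasawaAlgebra p ↦ (PowerSeries.subst S G : IwasawaAlgebra p)) :=
  Function.LeftInverse.injective (subst_substInv_subst_sqrtZ hS)

/-- **CONJUGATION `ι ∘ σ = σ ∘ ν`**: for `S = T(1+T)^r`, `2r = −1`, and every `G ∈ Λ`: `ι(G(S)) = G(ιS) = G(−S) = (νG)(S)` with
`(νG)(T) = G(−T)` (`PowerSeries.rescale (−1)`). The Iwasawa involution IS the sign change, read through `T ↦ S`.
[cite: Washington1997, §13.2] [cite: MazurTateTeitelbaum1986Invent, §I.17] -/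
theorem invol_subst_sqrtZ (hr : 2 * r = -1) (hS : S = X * binomialSeries ℤ_[p] r) (G : IwasawaAlgebra p) :
    invol p (PowerSeries.subst S G) = PowerSeries.subst S (rescale (-1 : ℤ_[p]) G) := by
  have hS' := hasSubst_sqrtZ hS
  have key : PowerSeries.subst (invSubOne p) S = PowerSeries.subst S ((-1 : ℤ_[p]) • X : IwasawaAlgebra p) := by
    rw [← invol_apply, subst_smul hS', subst_X hS', neg_one_smul, hS, invol_sqrtZ hr]
  rw [invol_apply, subst_comp_subst_apply hS' (hasSubst_invSubOne p), rescale_eq_subst,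
    subst_comp_subst_apply (HasSubst.smul_X' (-1 : ℤ_[p])) hS', key]

/-- `σ(T²) = S² = T + ιT = Z`. [cite: Washington1997, §13.2] -/
theorem subst_sqrtZ_X_sq (hr : 2 * r = -1) (hS : S = X * binomialSeries ℤ_[p] r) (hZ : Z = X + invol p X) :
    PowerSeries.subst S (X ^ 2 : IwasawaAlgebra p) = Z := by
  rw [subst_pow (hasSubst_sqrtZ hS), subst_X (hasSubst_sqrtZ hS), hS, sqrtZ_sq_eq_X_add_invol_X hr, hZ]

/-- `σ(K(T²)) = K(Z)`. [cite: Washington1997, §13.2] -/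
theorem subst_sqrtZ_subst_X_sq (hr : 2 * r = -1) (hS : S = X * binomialSeries ℤ_[p] r) (hZ : Z = X + invol p X)
    (K : IwasawaAlgebra p) :
    PowerSeries.subst S (PowerSeries.subst (X ^ 2 : IwasawaAlgebra p) K : IwasawaAlgebra p) = PowerSeries.subst Z K := by
  rw [subst_comp_subst_apply (HasSubst.X_pow two_ne_zero) (hasSubst_sqrtZ hS), subst_sqrtZ_X_sq hr hS hZ]

/-- `ι(H(Z)) = H(Z)`, `Z = T + ιT`: everything of the form `H(Z)` is `ι`-invariant. [cite: MazurTateTeitelbaum1986Invent, §I.17] -/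
theorem invol_subst_trace (hZ : Z = X + invol p X) (H : IwasawaAlgebra p) :
    invol p (PowerSeries.subst Z H) = PowerSeries.subst Z H := by
  have hι : invol p Z = Z := by rw [hZ]; exact invol_X_add_invol_X
  rw [invol_apply, subst_comp_subst_apply (hasSubst_trace hZ) (hasSubst_invSubOne p), ← invol_apply, hι]

/-- `ι(S·H(Z)) = −S·H(Z)` (`2r = −1`). [cite: MazurTateTeitelbaum1986Invent, §I.17] -/
theorem invol_sqrtZ_mul_subst_trace (hr : 2 * r = -1) (hS : S = X * binomialSeries ℤ_[p] r) (hZ : Z = X + invol p X)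
    (H : IwasawaAlgebra p) : invol p (S * PowerSeries.subst Z H) = -(S * PowerSeries.subst Z H) := by
  rw [map_mul, invol_subst_trace hZ, hS, invol_sqrtZ hr, neg_mul]

/-- `(H(Z))(0) = H(0)`. [folklore] -/
theorem constantCoeff_subst_trace (hZ : Z = X + invol p X) (H : IwasawaAlgebra p) :
    constantCoeff (PowerSeries.subst Z H : IwasawaAlgebra p) = constantCoeff H :=
  constantCoeff_subst_eq (by rw [hZ]; exact constantCoeff_X_add_invol_X) H

/-! ## §66 Even and odd series; the fixed ring `Λ^ι = ℤ_p⟦T + ιT⟧` and the anti-invariants `S·ℤ_p⟦T + ιT⟧` -/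

/-- An EVEN series (`G(−T) = G(T)`) is a series in `T²`: `G = K(T²)` with `K_k = G_{2k}` (`2 ≠ 0` in `ℤ_p`). [folklore] -/
theorem eq_subst_X_sq_of_rescale_eq_self {G : IwasawaAlgebra p} (hG : rescale (-1 : ℤ_[p]) G = G) :
    G = PowerSeries.subst (X ^ 2 : IwasawaAlgebra p) (PowerSeries.mk fun k ↦ coeff (2 * k) G) := by
  ext n
  rw [coeff_subst_X_pow two_ne_zero, Algebra.algebraMap_self, RingHom.id_apply, coeff_mk]
  split_ifs with h
  · rw [Nat.mul_div_cancel' h]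
  · have hn : Odd n := Nat.odd_iff.mpr (by omega)
    have h1 := congr_arg (coeff n) hG
    rw [coeff_rescale, hn.neg_one_pow, neg_one_mul] at h1
    have h2 : (2 : ℤ_[p]) * coeff n G = 0 := by linear_combination -h1
    exact (mul_eq_zero.mp h2).resolve_left two_ne_zero

/-- An ODD series (`G(−T) = −G(T)`) is `T` times a series in `T²`: `G = T·K(T²)` with `K_k = G_{2k+1}`. [folklore] -/
theorem eq_X_mul_subst_X_sq_of_rescale_eq_neg {G : IwasawaAlgebra p} (hG : rescale (-1 : ℤ_[p]) G = -G) :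
    G = X * PowerSeries.subst (X ^ 2 : IwasawaAlgebra p) (PowerSeries.mk fun k ↦ coeff (2 * k + 1) G) := by
  ext n
  obtain _ | n := n
  · have h1 := congr_arg (coeff 0) hG
    rw [coeff_rescale, pow_zero, one_mul, map_neg] at h1
    have h2 : (2 : ℤ_[p]) * coeff 0 G = 0 := by linear_combination h1
    rw [coeff_zero_X_mul, (mul_eq_zero.mp h2).resolve_left two_ne_zero]
  · rw [coeff_succ_X_mul, coeff_subst_X_pow two_ne_zero, Algebra.algebraMap_self, RingHom.id_apply, coeff_mk]
    split_ifs with h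
    · rw [Nat.mul_div_cancel' h]
    · have hn : Even (n + 1) := by
        rcases Nat.even_or_odd n with he | ho
        · exact absurd (even_iff_two_dvd.mp he) h
        · exact ho.add_one
      have h1 := congr_arg (coeff (n + 1)) hG
      rw [coeff_rescale, hn.neg_one_pow, one_mul, map_neg] at h1
      have h2 : (2 : ℤ_[p]) * coeff (n + 1) G = 0 := by linear_combination h1
      exact (mul_eq_zero.mp h2).resolve_left two_ne_zero

/-- **THE FIXED RING OF THE IWASAWA INVOLUTION: `Λ^ι = ℤ_p⟦T + ιT⟧`.** For odd `p` (witnessed by `r ∈ ℤ_p` with `2r = −1`,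
`S = T(1+T)^r`) and `Z = T + ιT`: `ι f = f` iff `f = H(Z)` for some `H ∈ Λ` (then unique, `subst_trace_injective`). Proof: `f = G(S)`,
`ι f = (νG)(S)`, so `ι f = f` iff `G` is even iff `G = K(T²)` iff `f = K(S²) = K(Z)`.
[cite: Washington1997, §13.2] [cite: MazurTateTeitelbaum1986Invent, §I.17] -/
theorem invol_eq_self_iff_exists_subst (hr : 2 * r = -1) (hS : S = X * binomialSeries ℤ_[p] r) (hZ : Z = X + invol p X)
    (f : IwasawaAlgebra p) : invol p f = f ↔ ∃ H : IwasawaAlgebra p, f = PowerSeries.subst Z H := by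
  refine ⟨fun hf ↦ ?_, ?_⟩
  · set G : IwasawaAlgebra p := PowerSeries.subst (substInvOfIsUnit S (isUnit_coeff_one_sqrtZ hS)) f with hG
    have hσ : PowerSeries.subst S G = f := subst_sqrtZ_subst_substInv hS f
    have hν : rescale (-1 : ℤ_[p]) G = G := by
      apply subst_sqrtZ_injective hS
      simp only
      rw [← invol_subst_sqrtZ hr hS, hσ, hf]
    refine ⟨PowerSeries.mk fun k ↦ coeff (2 * k) G, ?_⟩
    rw [← subst_sqrtZ_subst_X_sq hr hS hZ, ← eq_subst_X_sq_of_rescale_eq_self hν, hσ]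
  · rintro ⟨H, rfl⟩
    exact invol_subst_trace hZ H

/-- **THE ANTI-INVARIANTS: `ι f = −f` iff `f = S·H(Z)`** (`S = T(1+T)^r`, `2r = −1`, `Z = T + ιT`; `G` odd iff `G = T·K(T²)`).
[cite: Washington1997, §13.2] [cite: MazurTateTeitelbaum1986Invent, §I.17] -/
theorem invol_eq_neg_iff_exists_sqrtZ_mul_subst (hr : 2 * r = -1) (hS : S = X * binomialSeries ℤ_[p] r)
    (hZ : Z = X + invol p X) (f : IwasawaAlgebra p) :
    invol p f = -f ↔ ∃ H : IwasawaAlgebra p, f = S * PowerSeries.subst Z H := by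
  refine ⟨fun hf ↦ ?_, ?_⟩
  · set G : IwasawaAlgebra p := PowerSeries.subst (substInvOfIsUnit S (isUnit_coeff_one_sqrtZ hS)) f with hG
    have hσ : PowerSeries.subst S G = f := subst_sqrtZ_subst_substInv hS f
    have hS' := hasSubst_sqrtZ hS
    have hν : rescale (-1 : ℤ_[p]) G = -G := by
      apply subst_sqrtZ_injective hS
      simp only
      rw [← invol_subst_sqrtZ hr hS, hσ, hf, ← coe_substAlgHom hS', map_neg, coe_substAlgHom hS', hσ]
    refine ⟨PowerSeries.mk fun k ↦ coeff (2 * k + 1) G, ?_⟩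
    rw [← hσ]
    conv_lhs => rw [eq_X_mul_subst_X_sq_of_rescale_eq_neg hν, subst_mul hS', subst_X hS', subst_sqrtZ_subst_X_sq hr hS hZ]
  · rintro ⟨H, rfl⟩
    exact invol_sqrtZ_mul_subst_trace hr hS hZ H

/-- `ord_T Z = 2` (`Z = T + ιT = T² − T³ + ⋯`). [cite: Washington1997, §7.1] -/
theorem order_trace (hZ : Z = X + invol p X) : PowerSeries.order Z = 2 := by
  refine order_eq_nat.mpr ⟨by rw [hZ, coeff_two_X_add_invol_X]; exact one_ne_zero, fun i hi ↦ ?_⟩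
  interval_cases i
  · rw [coeff_zero_eq_constantCoeff, hZ, constantCoeff_X_add_invol_X]
  · rw [hZ]; exact coeff_one_X_add_invol_X

/-- `ord_T H(Z) = 2·ord_T H`: substituting the order-`2` element `Z` doubles orders (`Λ` a domain). [cite: Washington1997, §7.1] -/
theorem order_subst_trace (hZ : Z = X + invol p X) (H : IwasawaAlgebra p) :
    PowerSeries.order (PowerSeries.subst Z H : IwasawaAlgebra p) = 2 * PowerSeries.order H := by
  have hZ' := hasSubst_trace hZ
  by_cases hH : H = 0
  · rw [hH, ← coe_substAlgHom hZ', map_zero, order_zero, ENat.mul_top two_ne_zero]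
  set m := (PowerSeries.order H).toNat with hm
  have hHm : H = X ^ m * divXPowOrder H := X_pow_order_mul_divXPowOrder.symm
  have hK0 : constantCoeff (divXPowOrder H) ≠ 0 := fun h ↦ hH (constantCoeff_divXPowOrder_eq_zero_iff.mp h)
  have hordK : PowerSeries.order (PowerSeries.subst Z (divXPowOrder H) : IwasawaAlgebra p) = (0 : ℕ) := by
    refine order_eq_nat.mpr ⟨?_, fun i hi ↦ (Nat.not_lt_zero i hi).elim⟩
    rw [coeff_zero_eq_constantCoeff, constantCoeff_subst_trace hZ]
    exact hK0
  have hL : PowerSeries.order (PowerSeries.subst Z H : IwasawaAlgebra p) = ((m * 2 : ℕ) : ℕ∞) := by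
    rw [hHm, subst_mul hZ', subst_pow hZ', subst_X hZ', order_mul, order_pow, order_trace hZ, hordK]
    simp only [nsmul_eq_mul, Nat.cast_zero, add_zero, Nat.cast_mul, Nat.cast_ofNat]
  rw [hL, ← coe_toNat_order hH, ← hm]
  push_cast
  ring

/-- **`H ↦ H(Z)` is injective** (`Z = T + ιT`), so the `H` in `Λ^ι = {H(Z)}` is unique: `H(Z) = 0` forces `ord H = ∞`.
[cite: Washington1997, §7.1] -/
theorem subst_trace_injective (hZ : Z = X + invol p X) :
    Function.Injective (fun H : IwasawaAlgebra p ↦ (PowerSeries.subst Z H : IwasawaAlgebra p)) := by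
  intro H₁ H₂ h
  simp only at h
  have h0 : (PowerSeries.subst Z (H₁ - H₂) : IwasawaAlgebra p) = 0 := by rw [subst_sub (hasSubst_trace hZ), h, sub_self]
  have hord := order_subst_trace hZ (H₁ - H₂)
  rw [h0, order_zero] at hord
  have htop : PowerSeries.order (H₁ - H₂) = ⊤ := by
    by_contra hne
    exact WithTop.mul_ne_top (by decide) hne hord.symm
  exact sub_eq_zero.mp (order_eq_top.mp htop)

end NormCoordinate

end Summit.BirchSwinnertonDyer.BirchSwinnertonDyer.Theorems.EtaThetaFunctionalEquation

end
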